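import Summits.Ventures.LatticeQCDFlow.Scaling.HubAcceptanceLaw
import Summits.Ventures.LatticeQCDFlow.Scaling.SimulatedTemperingModeTorpid

/-!
HONEST FRAMING: exact (Metropolis-corrected) sampling algorithms for lattice gauge theory; figures
of merit are autocorrelation/cost numbers at stated couplings and volumes; no continuum-physics
claim.

# ColdReplicaAutocorrelation — THE SECTOR AUTOCORRELATION TIME OF EACH COLD REPLICA IS FLOORED BY ITS MEASURED SWAP
# ACCEPTANCES: FOR EVERY SWAP LIST, SECTOR-PRESERVING MAPS AND UPDATE ALLOCATION,
# `τ_int(1_A(x_k)) ≥ 2m·μ_k(A)μ_k(Aᶜ)/(t·Σ_{r ∋ k} α_r + 2m(1−t)·w_k·Q_k(A,Aᶜ)) − ½`; AN IDLE REPLICA OF LIST-DEGREE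
# `deg(k)` HAS `τ_int ≥ 2m·μ_k(A)μ_k(Aᶜ)/(t·deg(k)) − ½` (lean-2 GEN-23, ours)

Venture-side (OURS).  Cell `lqcd-flow` (pub-lqcd), unit `pub-lqcd-lean-2-g23`, 2026-08-26.  Chapter K, file 13: the
quantity the cell's figures of merit name — the integrated autocorrelation time of a replica's topological-sector
indicator — bounded from below by logged quantities.  Setting of `Scaling/HubAcceptanceLaw` (K9):
`P = t·ptGraphSwap μ e φ + (1−t)·prodKernel w M`, sector-preserving maps, `α_r = Σ_x min{π̃(x), π̃(x^{(r)})}` the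
stationary acceptance of entry `r`, `Q_k(A,Aᶜ)` the exit flow of replica `k`'s own update; `τ_int(g)` is
`asympVar(g)/(2Var(g))` (`Scaling/SimulatedTemperingModeTorpid`'s `tauInt_ge_var_div_dirichletForm`: Madras–Slade
Prop. 9.2.2, `τ_int ≥ Var/𝓔 − ½`).

## What is proved

* §1 **`ptGraph_dirichletForm_levelIndicator_le_acc`** — `𝓔_{GSw}(x ↦ f_A^{(μ_k)}(x_k)) ≤ (2m)⁻¹·Σ_{r ∋ k} α_r`;
  `lawVariance_levelIndicator` (`Var_π̃ = μ_k(A)μ_k(Aᶜ)`), `dirichletForm_levelIndicator_le`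
  (`𝓔_P ≤ t·Σ_{r∋k}α_r/(2m) + (1−t)·w_k·Q_k(A,Aᶜ)`).
* §2 **`coldReplica_tauInt_ge`** — `P` irreducible, `μ_k(A)μ_k(Aᶜ) > 0`:
  **`τ_int(f_A^{(μ_k)}(x_k)) ≥ μ_k(A)μ_k(Aᶜ)/(t·Σ_{r∋k}α_r/(2m) + (1−t)·w_k·Q_k(A,Aᶜ)) − ½` (the denominator is
  positive by irreducibility); **`idleReplica_tauInt_ge`** — `w_k·Q_k(A,Aᶜ) = 0`, `deg(k) ≥ 1`: `τ_int ≥ 2m·μ_k(A)μ_k(Aᶜ)/(t·deg(k)) − ½`.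

Reading (no numerics implied): a run that logs, for each cold replica, the acceptance of every pair it is proposed in
yields a certified LOWER bound on that replica's topological autocorrelation time — `2m·Var(sector)/(t·Σ acceptances)`
sampler steps, less one half —, and no map or schedule in the class can beat it; the idle form is the converse of
`Scaling/HubListCurrencies`' ceiling `τ_int ≤ 1/C − ½`.  NOT CLAIMED: upper bounds from acceptances; continuous
spaces; anything measured.  Literature grade (cell rule): OWN COMPOSITION (K9 + Madras–Slade 9.2.2 as typed); nothing
cited as a fact; no new bib keys.
-/

noncomputable section

open Finset Function
open Literature.Probability.MarkovChains

namespace Summit.Ventures.LatticeQCDFlow.Scaling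

variable {S : Type*} [Fintype S] [DecidableEq S] {K m : ℕ} {μ : Fin (K + 1) → S → ℝ}
  {M : Fin (K + 1) → S → S → ℝ} {w : Fin (K + 1) → ℝ} {t : ℝ} {e : Fin m → Fin (K + 1) × Fin (K + 1)}
  {φ : Fin m → Equiv.Perm S}

/-! ## §1 The level indicator: variance and Dirichlet forms -/

/-- The level-`k` sector indicator as a profile count with the indicator profile. [ours] -/
theorem levelIndicator_eq_profileCount (μ : Fin (K + 1) → S → ℝ) (A : Finset S) (k : Fin (K + 1))
    (x : Fin (K + 1) → S) :
    bottleneckTestFun (μ k) A (x k)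
      = ∑ i, (if i = k then (1 : ℝ) else 0) * bottleneckTestFun (μ i) A (x i) := by
  simp_rw [ite_mul, one_mul, zero_mul]
  rw [Finset.sum_ite_eq' univ k, if_pos (mem_univ _)]

/-- **`Var_π̃(f_A^{(μ_k)}(x_k)) = μ_k(A)μ_k(Aᶜ)`.** [ours] -/
theorem lawVariance_levelIndicator (hμ1 : ∀ k, ∑ u, μ k u = 1) (A : Finset S) (k : Fin (K + 1)) :
    lawVariance (tensorFun μ) (fun x : Fin (K + 1) → S => bottleneckTestFun (μ k) A (x k))
      = (∑ u ∈ A, μ k u) * ∑ u ∈ Aᶜ, μ k u := by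
  have hmean : lawMean (tensorFun μ) (fun x : Fin (K + 1) → S => bottleneckTestFun (μ k) A (x k)) = 0 := by
    unfold lawMean
    rw [sum_tensorFun_mul_apply μ hμ1 k (bottleneckTestFun (μ k) A)]
    exact sum_mul_bottleneckTestFun (μ k) A
  have hpi : piInner (tensorFun μ) (fun x : Fin (K + 1) → S => bottleneckTestFun (μ k) A (x k))
      (fun x => bottleneckTestFun (μ k) A (x k)) = (∑ u ∈ A, μ k u) * ∑ u ∈ Aᶜ, μ k u := by
    have h := ptBare_piInner_profileCount (μ := μ) hμ1 (fun i => if i = k then (1 : ℝ) else 0) A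
    simp_rw [← levelIndicator_eq_profileCount μ A k] at h
    rw [h]
    simp_rw [ite_pow, one_pow, zero_pow two_ne_zero, ite_mul, one_mul, zero_mul]
    rw [Finset.sum_ite_eq' univ k, if_pos (mem_univ _)]
  unfold lawVariance
  rw [hmean]
  unfold piInner at hpi
  rw [← hpi]
  exact sum_congr rfl fun x _ => by ring

/-- **`𝓔_{GSw}(x ↦ f_A^{(μ_k)}(x_k)) ≤ (2m)⁻¹·Σ_{r ∋ k} α_r`** (sector-preserving maps, distinct endpoints). [ours] -/
theorem ptGraph_dirichletForm_levelIndicator_le_acc (hμ : ∀ k x, 0 < μ k x) (hμ1 : ∀ k, ∑ u, μ k u = 1)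
    (he : ∀ r, (e r).1 ≠ (e r).2) {A : Finset S} (hφA : ∀ r u, φ r u ∈ A ↔ u ∈ A) (k : Fin (K + 1)) :
    dirichletForm (tensorFun μ) (ptGraphSwap μ e φ) (fun x : Fin (K + 1) → S => bottleneckTestFun (μ k) A (x k))
      ≤ 1 / (2 * m) * ∑ r ∈ univ.filter (fun r : Fin m => (e r).1 = k ∨ (e r).2 = k),
          ∑ x : Fin (K + 1) → S, min (tensorFun μ x) (tensorFun μ (edgeFlowSwap (φ r) (e r).1 (e r).2 x)) := by
  set a : Fin (K + 1) → ℝ := fun i => if i = k then (1 : ℝ) else 0 with ha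
  have hak : ∀ i, a i = if i = k then (1 : ℝ) else 0 := fun i => by rw [ha]
  have hfun : (fun x : Fin (K + 1) → S => bottleneckTestFun (μ k) A (x k))
      = fun x => ∑ i, a i * bottleneckTestFun (μ i) A (x i) := by
    funext x; rw [levelIndicator_eq_profileCount μ A k x]
  rw [hfun]
  refine (ptGraph_dirichletForm_swap_le_acc (e := e) (φ := φ) hμ he _).trans ?_
  refine mul_le_mul_of_nonneg_left ?_ (by positivity)
  have hpt : ∀ (r : Fin m) (x : Fin (K + 1) → S),
      min (tensorFun μ x) (tensorFun μ (edgeFlowSwap (φ r) (e r).1 (e r).2 x))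
          * ((∑ i, a i * bottleneckTestFun (μ i) A (x i))
              - ∑ i, a i * bottleneckTestFun (μ i) A (edgeFlowSwap (φ r) (e r).1 (e r).2 x i)) ^ 2
        ≤ if (e r).1 = k ∨ (e r).2 = k then
            min (tensorFun μ x) (tensorFun μ (edgeFlowSwap (φ r) (e r).1 (e r).2 x)) else 0 := by
    intro r x
    have hmin0 : 0 ≤ min (tensorFun μ x) (tensorFun μ (edgeFlowSwap (φ r) (e r).1 (e r).2 x)) :=
      le_min (tensorFun_pos hμ _).le (tensorFun_pos hμ _).le
    rw [graphProfileCount_sub_swap hμ1 a (hφA r) (he r) x]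
    have hsq : ((if x (e r).1 ∈ A then (0 : ℝ) else 1) - (if x (e r).2 ∈ A then (0 : ℝ) else 1)) ^ 2 ≤ 1 := by
      split_ifs <;> norm_num
    have hsq0 : 0 ≤ ((if x (e r).1 ∈ A then (0 : ℝ) else 1) - (if x (e r).2 ∈ A then (0 : ℝ) else 1)) ^ 2 :=
      sq_nonneg _
    by_cases h1 : (e r).1 = k
    · have h2 : (e r).2 ≠ k := fun h2 => he r (h1.trans h2.symm)
      rw [if_pos (Or.inl h1), hak, hak, if_pos h1, if_neg h2]; nlinarith
    · by_cases h2 : (e r).2 = k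
      · rw [if_pos (Or.inr h2), hak, hak, if_neg h1, if_pos h2]; nlinarith
      · rw [if_neg (not_or.mpr ⟨h1, h2⟩), hak, hak, if_neg h1, if_neg h2]; nlinarith
  rw [← Finset.sum_filter_add_sum_filter_not univ (fun r : Fin m => (e r).1 = k ∨ (e r).2 = k)]
  have hin : ∀ r ∈ univ.filter (fun r : Fin m => (e r).1 = k ∨ (e r).2 = k),
      ∑ x : Fin (K + 1) → S, min (tensorFun μ x) (tensorFun μ (edgeFlowSwap (φ r) (e r).1 (e r).2 x))
          * ((∑ i, a i * bottleneckTestFun (μ i) A (x i))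
              - ∑ i, a i * bottleneckTestFun (μ i) A (edgeFlowSwap (φ r) (e r).1 (e r).2 x i)) ^ 2
        ≤ ∑ x : Fin (K + 1) → S, min (tensorFun μ x) (tensorFun μ (edgeFlowSwap (φ r) (e r).1 (e r).2 x)) := by
    intro r hr
    have hr' := (Finset.mem_filter.mp hr).2
    refine sum_le_sum fun x _ => ?_
    have := hpt r x
    rw [if_pos hr'] at this
    exact this
  have hout : ∑ r ∈ univ.filter (fun r : Fin m => ¬((e r).1 = k ∨ (e r).2 = k)),
      ∑ x : Fin (K + 1) → S, min (tensorFun μ x) (tensorFun μ (edgeFlowSwap (φ r) (e r).1 (e r).2 x))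
          * ((∑ i, a i * bottleneckTestFun (μ i) A (x i))
              - ∑ i, a i * bottleneckTestFun (μ i) A (edgeFlowSwap (φ r) (e r).1 (e r).2 x i)) ^ 2 ≤ 0 := by
    refine Finset.sum_nonpos fun r hr => ?_
    have hr' := (Finset.mem_filter.mp hr).2
    refine Finset.sum_nonpos fun x _ => ?_
    have := hpt r x
    rw [if_neg hr'] at this
    exact this
  linarith [sum_le_sum hin]

/-- **`𝓔_P(x ↦ f_A^{(μ_k)}(x_k)) ≤ t·Σ_{r∋k}α_r/(2m) + (1−t)·w_k·Q_k(A,Aᶜ)`** (`0 ≤ t`). [ours] -/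
theorem dirichletForm_levelIndicator_le (hμ : ∀ k x, 0 < μ k x) (hμ1 : ∀ k, ∑ u, μ k u = 1)
    (hM : ∀ k, IsRowStochastic (M k)) (hMrev : ∀ k, DetailedBalance (μ k) (M k)) (ht0 : 0 ≤ t)
    (he : ∀ r, (e r).1 ≠ (e r).2) {A : Finset S} (hφA : ∀ r u, φ r u ∈ A ↔ u ∈ A) (k : Fin (K + 1)) :
    dirichletForm (tensorFun μ) (fun x y : Fin (K + 1) → S => t * ptGraphSwap μ e φ x y + (1 - t) * prodKernel w M x y)
        (fun x : Fin (K + 1) → S => bottleneckTestFun (μ k) A (x k))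
      ≤ t * (1 / (2 * m) * ∑ r ∈ univ.filter (fun r : Fin m => (e r).1 = k ∨ (e r).2 = k),
            ∑ x : Fin (K + 1) → S, min (tensorFun μ x) (tensorFun μ (edgeFlowSwap (φ r) (e r).1 (e r).2 x)))
        + (1 - t) * (w k * edgeMeasure (μ k) (M k) A Aᶜ) := by
  rw [weightedScheme_dirichletForm (Q := ptGraphSwap μ e φ) (w := w) (M := M)]
  have hupd : dirichletForm (tensorFun μ) (prodKernel w M) (fun x : Fin (K + 1) → S => bottleneckTestFun (μ k) A (x k))
      = w k * edgeMeasure (μ k) (M k) A Aᶜ := by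
    have hfun : (fun x : Fin (K + 1) → S => bottleneckTestFun (μ k) A (x k))
        = fun x => ∑ i, (if i = k then (1 : ℝ) else 0) * bottleneckTestFun (μ i) A (x i) := by
      funext x; rw [levelIndicator_eq_profileCount μ A k x]
    rw [hfun, prodKernel_dirichletForm_profileCount hμ1 hM hMrev w _ A]
    simp_rw [ite_pow, one_pow, zero_pow two_ne_zero, ite_mul, one_mul, zero_mul, mul_ite, mul_zero]
    rw [Finset.sum_ite_eq' univ k, if_pos (mem_univ _)]
  rw [hupd]
  exact add_le_add (mul_le_mul_of_nonneg_left (ptGraph_dirichletForm_levelIndicator_le_acc hμ hμ1 he hφA k) ht0)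
    le_rfl

/-! ## §2 The autocorrelation floors -/

/-- **THE SECTOR AUTOCORRELATION TIME OF A COLD REPLICA IS FLOORED BY ITS MEASURED ACCEPTANCES:** `P` irreducible,
`0 ≤ t ≤ 1`, `w` a probability vector, sector-preserving maps, `μ_k(A)μ_k(Aᶜ) > 0`, and
`D := t·Σ_{r∋k}α_r/(2m) + (1−t)·w_k·Q_k(A,Aᶜ)` (positive, as it dominates the Dirichlet form):
**`τ_int(f_A^{(μ_k)}(x_k)) ≥ μ_k(A)μ_k(Aᶜ)/D − ½`**. [ours] -/
theorem coldReplica_tauInt_ge [Nontrivial S] (he : ∀ r, (e r).1 ≠ (e r).2) (hμ : ∀ k x, 0 < μ k x)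
    (hμ1 : ∀ k, ∑ u, μ k u = 1) (hM : ∀ k, IsRowStochastic (M k)) (hMrev : ∀ k, DetailedBalance (μ k) (M k))
    (hw0 : ∀ k, 0 ≤ w k) (hw1 : ∑ k, w k = 1) (ht0 : 0 ≤ t) (ht1 : t ≤ 1) {A : Finset S}
    (hφA : ∀ r u, φ r u ∈ A ↔ u ∈ A) (k : Fin (K + 1)) (hAk : 0 < (∑ u ∈ A, μ k u) * ∑ u ∈ Aᶜ, μ k u)
    (hirr : IsIrreducible (fun x y : Fin (K + 1) → S => t * ptGraphSwap μ e φ x y + (1 - t) * prodKernel w M x y)) :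
    (∑ u ∈ A, μ k u) * (∑ u ∈ Aᶜ, μ k u)
        / (t * (1 / (2 * m) * ∑ r ∈ univ.filter (fun r : Fin m => (e r).1 = k ∨ (e r).2 = k),
              ∑ x : Fin (K + 1) → S, min (tensorFun μ x) (tensorFun μ (edgeFlowSwap (φ r) (e r).1 (e r).2 x)))
            + (1 - t) * (w k * edgeMeasure (μ k) (M k) A Aᶜ)) - 1 / 2
      ≤ asympVar (fun x : Fin (K + 1) → S => bottleneckTestFun (μ k) A (x k)) (tensorFun μ)
            (fun x y : Fin (K + 1) → S => t * ptGraphSwap μ e φ x y + (1 - t) * prodKernel w M x y)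
          / (2 * lawVariance (tensorFun μ) (fun x : Fin (K + 1) → S => bottleneckTestFun (μ k) A (x k))) := by
  have hP := weightedScheme_isRowStochastic (t := t) (w := w) (ptGraphSwap_isRowStochastic (e := e) (φ := φ) hμ) hM
    hw0 hw1 ht0 ht1
  have hDB := weightedScheme_detailedBalance (w := w) (ptGraphSwap_detailedBalance (e := e) (φ := φ) hμ) hMrev t
  have hV : 0 < lawVariance (tensorFun μ) (fun x : Fin (K + 1) → S => bottleneckTestFun (μ k) A (x k)) := by
    rw [lawVariance_levelIndicator hμ1 A k]; exact hAk
  have h := tauInt_ge_var_div_dirichletForm (tensorFun_pos hμ) (sum_tensorFun_eq_one μ hμ1) hP hDB hirr hV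
  refine le_trans ?_ h
  rw [lawVariance_levelIndicator hμ1 A k]
  have hEpos := dirichletForm_pos_of_lawVariance_pos (tensorFun_pos hμ) (sum_tensorFun_eq_one μ hμ1) hP hDB hirr hV
  have hEle := dirichletForm_levelIndicator_le (w := w) (e := e) (φ := φ) hμ hμ1 hM hMrev ht0 he hφA k
  exact sub_le_sub_right (div_le_div_of_nonneg_left hAk.le hEpos hEle) _

/-- **AN IDLE COLD REPLICA OF LIST-DEGREE `deg(k) ≥ 1`:** `w_k·Q_k(A,Aᶜ) = 0`, `t > 0` ⇒
**`τ_int(f_A^{(μ_k)}(x_k)) ≥ 2m·μ_k(A)μ_k(Aᶜ)/(t·deg(k)) − ½`** — every acceptance is at most one. [ours] -/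
theorem idleReplica_tauInt_ge [Nontrivial S] (hm : 1 ≤ m) (he : ∀ r, (e r).1 ≠ (e r).2) (hμ : ∀ k x, 0 < μ k x)
    (hμ1 : ∀ k, ∑ u, μ k u = 1) (hM : ∀ k, IsRowStochastic (M k)) (hMrev : ∀ k, DetailedBalance (μ k) (M k))
    (hw0 : ∀ k, 0 ≤ w k) (hw1 : ∑ k, w k = 1) (ht0 : 0 < t) (ht1 : t ≤ 1) {A : Finset S}
    (hφA : ∀ r u, φ r u ∈ A ↔ u ∈ A) (k : Fin (K + 1)) (hAk : 0 < (∑ u ∈ A, μ k u) * ∑ u ∈ Aᶜ, μ k u)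
    (hidle : w k * edgeMeasure (μ k) (M k) A Aᶜ = 0)
    (hdeg : 1 ≤ (univ.filter (fun r : Fin m => (e r).1 = k ∨ (e r).2 = k)).card)
    (hirr : IsIrreducible (fun x y : Fin (K + 1) → S => t * ptGraphSwap μ e φ x y + (1 - t) * prodKernel w M x y)) :
    2 * m * ((∑ u ∈ A, μ k u) * ∑ u ∈ Aᶜ, μ k u)
          / (t * ((univ.filter (fun r : Fin m => (e r).1 = k ∨ (e r).2 = k)).card : ℝ)) - 1 / 2
      ≤ asympVar (fun x : Fin (K + 1) → S => bottleneckTestFun (μ k) A (x k)) (tensorFun μ)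
            (fun x y : Fin (K + 1) → S => t * ptGraphSwap μ e φ x y + (1 - t) * prodKernel w M x y)
          / (2 * lawVariance (tensorFun μ) (fun x : Fin (K + 1) → S => bottleneckTestFun (μ k) A (x k))) := by
  have hmpos : (0 : ℝ) < m := Nat.cast_pos.mpr (by omega)
  have hdegpos : (0 : ℝ) < ((univ.filter (fun r : Fin m => (e r).1 = k ∨ (e r).2 = k)).card : ℝ) := by
    exact_mod_cast hdeg
  have hP := weightedScheme_isRowStochastic (t := t) (w := w) (ptGraphSwap_isRowStochastic (e := e) (φ := φ) hμ) hM
    hw0 hw1 ht0.le ht1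
  have hDB := weightedScheme_detailedBalance (w := w) (ptGraphSwap_detailedBalance (e := e) (φ := φ) hμ) hMrev t
  have hV : 0 < lawVariance (tensorFun μ) (fun x : Fin (K + 1) → S => bottleneckTestFun (μ k) A (x k)) := by
    rw [lawVariance_levelIndicator hμ1 A k]; exact hAk
  have h := tauInt_ge_var_div_dirichletForm (tensorFun_pos hμ) (sum_tensorFun_eq_one μ hμ1) hP hDB hirr hV
  refine le_trans ?_ h
  rw [lawVariance_levelIndicator hμ1 A k]
  have hEpos := dirichletForm_pos_of_lawVariance_pos (tensorFun_pos hμ) (sum_tensorFun_eq_one μ hμ1) hP hDB hirr hV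
  have hEle := dirichletForm_levelIndicator_le (w := w) (e := e) (φ := φ) hμ hμ1 hM hMrev ht0.le he hφA k
  rw [hidle, mul_zero, add_zero] at hEle
  -- every acceptance is at most one
  have hacc : ∑ r ∈ univ.filter (fun r : Fin m => (e r).1 = k ∨ (e r).2 = k),
      ∑ x : Fin (K + 1) → S, min (tensorFun μ x) (tensorFun μ (edgeFlowSwap (φ r) (e r).1 (e r).2 x))
        ≤ ((univ.filter (fun r : Fin m => (e r).1 = k ∨ (e r).2 = k)).card : ℝ) := by
    have hone : ∀ r ∈ univ.filter (fun r : Fin m => (e r).1 = k ∨ (e r).2 = k),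
        ∑ x : Fin (K + 1) → S, min (tensorFun μ x) (tensorFun μ (edgeFlowSwap (φ r) (e r).1 (e r).2 x)) ≤ 1 :=
      fun r _ => (sum_le_sum fun x _ => min_le_left _ _).trans (le_of_eq (sum_tensorFun_eq_one μ hμ1))
    refine (sum_le_sum hone).trans (le_of_eq ?_)
    rw [Finset.sum_const, nsmul_eq_mul, mul_one]
  have hEle' : dirichletForm (tensorFun μ) (fun x y : Fin (K + 1) → S =>
        t * ptGraphSwap μ e φ x y + (1 - t) * prodKernel w M x y) (fun x : Fin (K + 1) → S => bottleneckTestFun (μ k) A (x k))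
      ≤ t * ((univ.filter (fun r : Fin m => (e r).1 = k ∨ (e r).2 = k)).card : ℝ) / (2 * m) := by
    refine hEle.trans ?_
    rw [show t * ((univ.filter (fun r : Fin m => (e r).1 = k ∨ (e r).2 = k)).card : ℝ) / (2 * m)
      = t * (1 / (2 * m) * ((univ.filter (fun r : Fin m => (e r).1 = k ∨ (e r).2 = k)).card : ℝ)) by ring]
    exact mul_le_mul_of_nonneg_left (mul_le_mul_of_nonneg_left hacc (by positivity)) ht0.le
  refine sub_le_sub_right ?_ _
  calc 2 * m * ((∑ u ∈ A, μ k u) * ∑ u ∈ Aᶜ, μ k u)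
          / (t * ((univ.filter (fun r : Fin m => (e r).1 = k ∨ (e r).2 = k)).card : ℝ))
      = ((∑ u ∈ A, μ k u) * ∑ u ∈ Aᶜ, μ k u)
          / (t * ((univ.filter (fun r : Fin m => (e r).1 = k ∨ (e r).2 = k)).card : ℝ) / (2 * m)) := by
        field_simp
    _ ≤ ((∑ u ∈ A, μ k u) * ∑ u ∈ Aᶜ, μ k u)
          / dirichletForm (tensorFun μ) (fun x y : Fin (K + 1) → S =>
              t * ptGraphSwap μ e φ x y + (1 - t) * prodKernel w M x y)
            (fun x : Fin (K + 1) → S => bottleneckTestFun (μ k) A (x k)) :=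
        div_le_div_of_nonneg_left hAk.le hEpos hEle'

end Summit.Ventures.LatticeQCDFlow.Scaling

end
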